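import Literature.NumberTheory.Transcendental.GoncharovFormalIteratedIntegrals
import Mathlib.Data.List.Sublists
import Mathlib.Algebra.BigOperators.Ring.Finset
import HarnessLib

/-!
# Goncharov's coproduct descends to `𝓘_•(S)` (proof of `coproduct_descends`)

A. B. Goncharov, *Galois symmetries of fundamental groupoids and noncommutative geometry*, Duke
Math. J. **128** (2005), 209–284 (arXiv:math/0208144), §2.1, Proposition 2.2: the coproduct

  `Δ 𝕀(a₀; a₁…a_m; a_{m+1}) = Σ_{0=i₀<i₁<⋯<i_k<i_{k+1}=m+1} 𝕀(a₀; a_{i₁}…a_{i_k}; a_{m+1}) ⊗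
     ∏_{p=0}^{k} 𝕀(a_{i_p}; a_{i_p+1}…a_{i_{p+1}-1}; a_{i_{p+1}})`

"provides `𝓘_•(S)` … with the structure of a commutative, graded Hopf algebra". This file proves
the named fact `coproduct_descends S` of `GoncharovFormalIteratedIntegrals.lean` — the
well-definedness half: `Δ`, defined on the free algebra `𝓘̃_•(S)`, kills the relations (i) unit,
(ii) shuffle product, (iii) path composition, (iv) `𝕀(a; w; a) = 0` modulo the relations — as
the theorem `coproduct_descends_holds` (axioms `propext`, `Classical.choice`, `Quot.sound`).
Cases (i) and (iv) are in the definitions file; (ii) and (iii) are the content here.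

## The argument (Goncharov's proof of Thm 2.5 (c), made explicit)

Goncharov deduces Prop. 2.2 from Theorem 2.5, `𝓘_•(S) = 𝒪(G(S))` with `G(S)` the group of
automorphisms `F` of the path algebra `P(S)` preserving the `∘`-product and the coproduct `δ`;
the key lines of that proof (p. 9 of the arXiv version) are: an automorphism is determined by the
series `F(p_{a,b}) = Σ_w I_{a,w,b}(F) p_{a,w,b}`; "(iii) is equivalent to
`F(p_{a,b}) = F(p_{a,x}) ∘ F(p_{x,b})`"; "given that `F` preserves both products, the fact that `F`
commutes with `δ` is equivalent to the shuffle product formula (ii)"; and the coproduct of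
`𝒪(Aut)` "is identified with `Δ` … from the very definitions" (composition of automorphisms).
We formalize exactly the functor-of-points content of these lines, for families
`J, K : S → List S → S → B` with values in a commutative ring `B`:

* `WordSeries S B = (List S → B)`, the ring `B⟨⟨S⟩⟩` of non-commutative series (Cauchy product;
  this is `P(S)_{a,b}` completed, the `∘`-product being concatenation), the letters `X k`, the
  two-variable series `WordSeries S (WordSeries S B)` with `tensor f g = f ⊗ g`, and the
  **deshuffle coproduct** `delta f (u, v) = Σ_{w ∈ u ш v} f w` (Goncharov's `δ`, letters
  primitive), a ring homomorphism (`delta_mul`: cuts of shuffles are shuffles of cuts,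
  `sum_shuffleWord_cutSum`);
* `phi K a b = Φ_{a,b} = F(p_{a,b})` and `psi K a c b = Φ_{a,c₁} c₁ Φ_{c₁,c₂} ⋯ c_k Φ_{c_k,b} =
  F(p_{a,c,b})`; (iii) reads `Φ_{a,x}Φ_{x,b} = Φ_{a,b}` and gives `Ψ(a;c;x)Ψ(x;c';b) = Ψ(a;cc';b)`
  (`psi_mul_psi`, "`F` preserves `∘`"); (ii) reads `δΦ = Φ ⊗ Φ` and with (iii) gives
  `δΨ(a;c;b) = Σ_{deshuffles (d,e) of c} Ψ(a;d;b) ⊗ Ψ(a;e;b)` (`delta_psi`, "`F` commutes with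
  `δ`");
* Goncharov's formula with the left factor read in `J` and the right in `K` is
  `conv J K a w b` (`= (π ⊗ π) Δ 𝕀(a;w;b)` for `J = 𝕀 ⊗ 1`, `K = 1 ⊗ 𝕀`,
  `map_coproductFree_gen`), and its generating series is the contraction
  `Σ_c J(a;c;b) Ψ^K(a;c;b)` (`conv_eq_contr`, via `sum_splittings_eq_sum_psiF`: the coefficient
  of `w` in `Ψ^K(a;c;b)` is the sum of Goncharov's gap products over the splittings of `w` with
  kept word `c`);
* hence `conv J K` satisfies (iii) if `J, K` do (`conv_path`) and (ii) if `J` satisfies (ii) and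
  `K` satisfies (ii), (iii) (`conv_shuffle`; the regrouping uses the duality "multiplicity of
  `(d,e)` among deshuffles of `c` = multiplicity of `c` in `d ш e`", `count_desh`).

Shuffle-algebra background (shuffle/deconcatenation bialgebra, deshuffle coproduct dual to the
shuffle product): C. Reutenauer, *Free Lie algebras* (1993), §1.4–1.5. Everything here is proved;
no definition of the definitions file is changed and no named fact is introduced.

## References

* A. B. Goncharov, *Galois symmetries of fundamental groupoids and noncommutative geometry*,
  Duke Math. J. 128 (2005), 209–284, §2.1–2.4, Prop. 2.2, Thm. 2.5 (arXiv:math/0208144).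
  [Goncharov2005]
* C. Reutenauer, *Free Lie Algebras*, London Math. Soc. Monographs 7, Oxford (1993), §1.4–1.5.
  [Reutenauer1993]
-/

noncomputable section

open scoped TensorProduct

namespace Literature.NumberTheory.Transcendental

namespace GoncharovFormalIteratedIntegrals

universe u v

/-! ### Non-commutative formal series on words -/

/-- `WordSeries S R`: all maps `List S → R`, i.e. non-commutative formal power series
`Σ_w f(w)·w` in letters from `S` with coefficients in `R`. [folklore] -/
def WordSeries (S : Type u) (R : Type v) : Type (max u v) := List S → R

namespace WordSeries

variable {S : Type u} {R : Type v}

/-- Two series with the same coefficients are equal. [folklore] -/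
@[ext] theorem ext {f g : WordSeries S R} (h : ∀ w, f w = g w) : f = g := funext h

/-- The left shift `(∂_s f)(u) = f(s u)`. [folklore] -/
def shift (s : S) (f : WordSeries S R) : WordSeries S R := fun u => f (s :: u)

/-- Coefficients of a shift. [folklore] -/
@[simp] theorem shift_apply (s : S) (f : WordSeries S R) (u : List S) :
    shift s f u = f (s :: u) := rfl

variable [Ring R]

/-- Coefficientwise addition. [folklore] -/
instance instAddCommGroup : AddCommGroup (WordSeries S R) := Pi.addCommGroup

/-- `0`. [folklore] -/
instance instInhabited : Inhabited (WordSeries S R) := ⟨0⟩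

/-- Coefficients of `0`. [folklore] -/
@[simp] theorem zero_apply (w : List S) : (0 : WordSeries S R) w = 0 := rfl

/-- Coefficients of a sum. [folklore] -/
@[simp] theorem add_apply (f g : WordSeries S R) (w : List S) : (f + g) w = f w + g w := rfl

/-- Coefficients of a negation. [folklore] -/
@[simp] theorem neg_apply (f : WordSeries S R) (w : List S) : (-f) w = -f w := rfl

/-- Coefficients of a difference. [folklore] -/
@[simp] theorem sub_apply (f g : WordSeries S R) (w : List S) : (f - g) w = f w - g w := rfl

/-- Taking the coefficient of `w` is additive. [folklore] -/
def applyAddHom (w : List S) : WordSeries S R →+ R where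
  toFun f := f w
  map_zero' := rfl
  map_add' _ _ := rfl

/-- Coefficient of a finite sum. [folklore] -/
theorem finset_sum_apply {ι : Type*} (s : Finset ι) (F : ι → WordSeries S R) (w : List S) :
    (∑ i ∈ s, F i) w = ∑ i ∈ s, F i w :=
  map_sum (applyAddHom w) F s

/-- Coefficient of a list sum. [folklore] -/
theorem list_sum_apply (L : List (WordSeries S R)) (w : List S) :
    L.sum w = (L.map fun f => f w).sum :=
  map_list_sum (applyAddHom w) L

/-- The constant series `r`. [folklore] -/
def C (r : R) : WordSeries S R
  | [] => r
  | _ :: _ => 0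

/-- Constant term of a constant. [folklore] -/
@[simp] theorem C_nil (r : R) : (C r : WordSeries S R) [] = r := rfl

/-- Higher coefficients of a constant vanish. [folklore] -/
@[simp] theorem C_cons (r : R) (s : S) (w : List S) : (C r : WordSeries S R) (s :: w) = 0 := rfl

/-- `1` is the constant series. [folklore] -/
instance instOne : One (WordSeries S R) := ⟨C 1⟩

/-- Constant term of `1`. [folklore] -/
@[simp] theorem one_nil : (1 : WordSeries S R) [] = 1 := rfl

/-- Higher coefficients of `1` vanish. [folklore] -/
@[simp] theorem one_cons (s : S) (w : List S) : (1 : WordSeries S R) (s :: w) = 0 := rfl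

/-- The Cauchy (concatenation) product `(f g)(w) = Σ_{w = w₁w₂} f(w₁) g(w₂)`. [folklore] -/
instance instMul : Mul (WordSeries S R) :=
  ⟨fun f g w => ∑ k ∈ Finset.range (w.length + 1), f (w.take k) * g (w.drop k)⟩

/-- Coefficients of a product. [folklore] -/
theorem mul_apply (f g : WordSeries S R) (w : List S) :
    (f * g) w = ∑ k ∈ Finset.range (w.length + 1), f (w.take k) * g (w.drop k) := rfl

/-- Constant term of a product. [folklore] -/
@[simp] theorem mul_apply_nil (f g : WordSeries S R) : (f * g) [] = f [] * g [] := by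
  simp [mul_apply]

/-- The recursion of the Cauchy product: `(fg)(s w) = f(∅) g(s w) + ((∂_s f) g)(w)`. [folklore] -/
theorem mul_apply_cons (f g : WordSeries S R) (s : S) (w : List S) :
    (f * g) (s :: w) = f [] * g (s :: w) + (shift s f * g) w := by
  rw [mul_apply, mul_apply, List.length_cons, Finset.sum_range_succ', add_comm]
  rfl

/-- `0 · f = 0`. [folklore] -/
protected theorem zero_mul (f : WordSeries S R) : (0 : WordSeries S R) * f = 0 := by
  ext w; simp [mul_apply]

/-- `f · 0 = 0`. [folklore] -/
protected theorem mul_zero (f : WordSeries S R) : f * (0 : WordSeries S R) = 0 := by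
  ext w; simp [mul_apply]

/-- Right distributivity. [folklore] -/
protected theorem add_mul (f g h : WordSeries S R) : (f + g) * h = f * h + g * h := by
  ext w; simp [mul_apply, add_mul, Finset.sum_add_distrib]

/-- Left distributivity. [folklore] -/
protected theorem mul_add (f g h : WordSeries S R) : f * (g + h) = f * g + f * h := by
  ext w; simp [mul_apply, mul_add, Finset.sum_add_distrib]

/-- The shift is additive. [folklore] -/
@[simp] theorem shift_add (s : S) (f g : WordSeries S R) :
    shift s (f + g) = shift s f + shift s g :=
  rfl

/-- The shift of `0`. [folklore] -/
@[simp] theorem shift_zero (s : S) : shift s (0 : WordSeries S R) = 0 := rfl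

/-- The shift kills constants. [folklore] -/
@[simp] theorem shift_C (s : S) (r : R) : shift s (C r : WordSeries S R) = 0 := rfl

/-- The shift kills `1`. [folklore] -/
@[simp] theorem shift_one (s : S) : shift s (1 : WordSeries S R) = 0 := rfl

/-- Multiplication by a constant on the left is coefficientwise. [folklore] -/
@[simp] theorem C_mul_apply (r : R) (f : WordSeries S R) (w : List S) :
    (C r * f : WordSeries S R) w = r * f w := by
  cases w with
  | nil => simp
  | cons s w => rw [mul_apply_cons, shift_C, WordSeries.zero_mul]; simp

/-- Leibniz rule for the shift: `∂_s (fg) = f(∅) ∂_s g + (∂_s f) g`. [folklore] -/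
theorem shift_mul (s : S) (f g : WordSeries S R) :
    shift s (f * g) = C (f []) * shift s g + shift s f * g := by
  ext u
  rw [shift_apply, mul_apply_cons, add_apply, C_mul_apply, shift_apply]

/-- `1 · f = f`. [folklore] -/
protected theorem one_mul (f : WordSeries S R) : (1 : WordSeries S R) * f = f := by
  ext w
  cases w with
  | nil => simp
  | cons s w => rw [mul_apply_cons, shift_one, WordSeries.zero_mul]; simp

/-- `f · 1 = f`. [folklore] -/
protected theorem mul_one (f : WordSeries S R) : f * (1 : WordSeries S R) = f := by
  ext w
  induction w generalizing f with
  | nil => simp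
  | cons s w ih => rw [mul_apply_cons, ih, one_cons, mul_zero, zero_add, shift_apply]

/-- Associativity of the Cauchy product. [folklore] -/
protected theorem mul_assoc (f g h : WordSeries S R) : f * g * h = f * (g * h) := by
  ext w
  induction w generalizing f g h with
  | nil => simp [mul_assoc]
  | cons s w ih =>
    rw [mul_apply_cons, mul_apply_cons, shift_mul, WordSeries.add_mul, add_apply, ih, ih,
      mul_apply_nil, mul_apply_cons, C_mul_apply, mul_add, mul_assoc, add_assoc]

/-- Natural number constants. [folklore] -/
instance instAddMonoidWithOne : AddMonoidWithOne (WordSeries S R) where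
  natCast n := C (n : R)
  natCast_zero := by ext w; cases w <;> simp
  natCast_succ n := by ext w; cases w <;> simp

/-- `WordSeries S R` is a semiring under the Cauchy product. [folklore] -/
instance instSemiring : Semiring (WordSeries S R) where
  zero_mul := WordSeries.zero_mul
  mul_zero := WordSeries.mul_zero
  left_distrib := WordSeries.mul_add
  right_distrib := WordSeries.add_mul
  mul_assoc := WordSeries.mul_assoc
  one_mul := WordSeries.one_mul
  mul_one := WordSeries.mul_one

/-- `WordSeries S R` is a ring under the Cauchy product (the ring `R⟨⟨S⟩⟩` of non-commutative
formal power series). [folklore] -/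
instance instRing : Ring (WordSeries S R) where

section Letter

variable [DecidableEq S]

/-- The letter `k` as a series (the indicator of the one-letter word `k`). [folklore] -/
def X (k : S) : WordSeries S R := fun w => if w = [k] then 1 else 0

/-- Coefficients of a letter. [folklore] -/
theorem X_apply (k : S) (w : List S) : (X k : WordSeries S R) w = if w = [k] then 1 else 0 := rfl

/-- A letter has no constant term. [folklore] -/
@[simp] theorem X_nil (k : S) : (X k : WordSeries S R) [] = 0 := by
  simp [X_apply]

/-- The shift of a letter: `∂_s k = δ_{s,k}`. [folklore] -/
theorem shift_X (s k : S) : shift s (X k : WordSeries S R) = if s = k then 1 else 0 := by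
  ext u
  simp only [shift_apply, X_apply, List.cons.injEq]
  by_cases hs : s = k
  · subst hs
    cases u <;> simp
  · simp [hs]

/-- Left multiplication by a letter: `(k g)(s w) = δ_{s,k} g(w)`. [folklore] -/
theorem X_mul_apply_cons (k : S) (g : WordSeries S R) (s : S) (w : List S) :
    (X k * g : WordSeries S R) (s :: w) = if s = k then g w else 0 := by
  rw [mul_apply_cons, X_nil, zero_mul, zero_add, shift_X]
  split_ifs <;> simp

/-- Left multiplication by a letter has no constant term. [folklore] -/
@[simp] theorem X_mul_apply_nil (k : S) (g : WordSeries S R) :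
    (X k * g : WordSeries S R) [] = 0 := by
  simp

/-- `(f k g)(∅) = 0`. [folklore] -/
@[simp] theorem mul_X_mul_apply_nil (f : WordSeries S R) (k : S) (g : WordSeries S R) :
    (f * X k * g : WordSeries S R) [] = 0 := by
  rw [mul_assoc, mul_apply_nil, X_mul_apply_nil, mul_zero]

/-- The recursion `(f k g)(s w) = δ_{s,k} f(∅) g(w) + ((∂_s f) k g)(w)`. [folklore] -/
theorem mul_X_mul_apply_cons (f : WordSeries S R) (k : S) (g : WordSeries S R) (s : S)
    (w : List S) :
    (f * X k * g : WordSeries S R) (s :: w) =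
      (if s = k then f [] * g w else 0) + (shift s f * X k * g : WordSeries S R) w := by
  rw [mul_assoc, mul_apply_cons, X_mul_apply_cons, ← mul_assoc]
  split_ifs <;> simp

end Letter

/-! #### Cuts of shuffles: the shuffle/deconcatenation compatibility -/

section ShuffleCut

variable {M : Type*} [AddCommMonoid M]

/-- `cutSum F w = Σ_{w = w₁w₂} F w₁ w₂`, the sum over the deconcatenations of `w`. [folklore] -/
def cutSum (F : List S → List S → M) (w : List S) : M :=
  ∑ k ∈ Finset.range (w.length + 1), F (w.take k) (w.drop k)

/-- The only cut of the empty word. [folklore] -/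
@[simp] theorem cutSum_nil (F : List S → List S → M) : cutSum F [] = F [] [] := by
  simp [cutSum]

/-- Cuts of `a w`: the cut before `a`, and the cuts of `w` with `a` prepended on the left.
[folklore] -/
theorem cutSum_cons (F : List S → List S → M) (a : S) (w : List S) :
    cutSum F (a :: w) = F [] (a :: w) + cutSum (fun p q => F (a :: p) q) w := by
  rw [cutSum, cutSum, List.length_cons, Finset.sum_range_succ', add_comm]
  rfl

/-- `shuffleCutSum F u v = Σ_{u=u₁u₂, v=v₁v₂} Σ_{w₁ ∈ u₁ ш v₁} Σ_{w₂ ∈ u₂ ш v₂} F w₁ w₂`: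
shuffles of the cuts. [folklore] -/
def shuffleCutSum (F : List S → List S → M) (u v : List S) : M :=
  ∑ i ∈ Finset.range (u.length + 1), ∑ j ∈ Finset.range (v.length + 1),
    ((MZV.shuffleWord (u.take i) (v.take j)).map fun w₁ =>
      ((MZV.shuffleWord (u.drop i) (v.drop j)).map fun w₂ => F w₁ w₂).sum).sum

/-- Shuffles of cuts with `u = ∅` are the cuts of `v`. [folklore] -/
theorem shuffleCutSum_nil_left (F : List S → List S → M) (v : List S) :
    shuffleCutSum F [] v = cutSum F v := by
  simp [shuffleCutSum, cutSum]

/-- Shuffles of cuts with `v = ∅` are the cuts of `u`. [folklore] -/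
theorem shuffleCutSum_nil_right (F : List S → List S → M) (u : List S) :
    shuffleCutSum F u [] = cutSum F u := by
  simp [shuffleCutSum, cutSum]

/-- The recursion of `shuffleCutSum` in both words at once (mirrors
`(a u) ш (b v) = a (u ш b v) + b (a u ш v)`). [folklore] -/
theorem shuffleCutSum_cons_cons (F : List S → List S → M) (a b : S) (u v : List S) :
    shuffleCutSum F (a :: u) (b :: v) =
      ((MZV.shuffleWord (a :: u) (b :: v)).map (F [])).sum +
        shuffleCutSum (fun p q => F (a :: p) q) u (b :: v) +
          shuffleCutSum (fun p q => F (b :: p) q) (a :: u) v := by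
  simp only [shuffleCutSum, List.length_cons, Finset.sum_range_succ', List.take_succ_cons,
    List.drop_succ_cons, List.take_zero, List.drop_zero, MZV.shuffleWord_nil_left,
    MZV.shuffleWord_nil_right, MZV.shuffleWord_cons_cons, List.map_append, List.sum_append,
    List.map_map, Function.comp_def, List.map_cons, List.map_nil, List.sum_cons, List.sum_nil,
    add_zero, Finset.sum_add_distrib]
  abel

/-- **Cuts of shuffles are shuffles of cuts** (the compatibility of the shuffle product with the
deconcatenation coproduct, i.e. the bialgebra axiom of the shuffle Hopf algebra; classical,
Reutenauer 1993, Ch. 1):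
`Σ_{w ∈ u ш v} Σ_{w = w₁w₂} F(w₁, w₂) = Σ_{u=u₁u₂, v=v₁v₂} Σ_{w₁ ∈ u₁шv₁} Σ_{w₂ ∈ u₂шv₂} F(w₁, w₂)`.
[folklore] -/
theorem sum_shuffleWord_cutSum (F : List S → List S → M) :
    ∀ u v : List S, ((MZV.shuffleWord u v).map (cutSum F)).sum = shuffleCutSum F u v
  | [], v => by simp [shuffleCutSum_nil_left]
  | a :: u, [] => by simp [shuffleCutSum_nil_right]
  | a :: u, b :: v => by
    rw [shuffleCutSum_cons_cons, ← sum_shuffleWord_cutSum (fun p q => F (a :: p) q) u (b :: v),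
      ← sum_shuffleWord_cutSum (fun p q => F (b :: p) q) (a :: u) v, MZV.shuffleWord_cons_cons]
    simp only [List.map_append, List.sum_append, List.map_map, Function.comp_def, cutSum_cons,
      List.sum_map_add]
    abel

end ShuffleCut

/-! #### Two-variable series, the deshuffle coproduct `δ` -/

section Delta

variable {B : Type v} [CommRing B]

/-- `f ⊗ g` as a two-variable series `(u, v) ↦ f(u) g(v)` (an element of the completed tensor
square, realised as series in `u` with coefficients series in `v`). [folklore] -/
def tensor (f g : WordSeries S B) : WordSeries S (WordSeries S B) := fun u v => f u * g v

/-- Coefficients of `f ⊗ g`. [folklore] -/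
@[simp] theorem tensor_apply (f g : WordSeries S B) (u v : List S) : tensor f g u v = f u * g v :=
  rfl

/-- `(f ⊗ g)(f' ⊗ g') = ff' ⊗ gg'` (coefficients commute). [folklore] -/
theorem tensor_mul_tensor (f g f' g' : WordSeries S B) :
    tensor f g * tensor f' g' = tensor (f * f') (g * g') := by
  refine WordSeries.ext fun u => WordSeries.ext fun v => ?_
  rw [mul_apply, finset_sum_apply, tensor_apply, mul_apply, mul_apply, Finset.sum_mul_sum]
  refine Finset.sum_congr rfl fun i _ => ?_
  rw [mul_apply]
  refine Finset.sum_congr rfl fun j _ => ?_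
  rw [tensor_apply, tensor_apply]
  ring

/-- `1 ⊗ 1 = 1`. [folklore] -/
@[simp] theorem tensor_one_one : tensor (1 : WordSeries S B) 1 = 1 := by
  refine WordSeries.ext fun u => WordSeries.ext fun v => ?_
  cases u <;> cases v <;> simp

/-- `⊗` is additive on the left. [folklore] -/
theorem tensor_add_left (f f' g : WordSeries S B) :
    tensor (f + f') g = tensor f g + tensor f' g := by
  refine WordSeries.ext fun u => WordSeries.ext fun v => ?_
  simp [add_mul]

/-- `⊗` is additive on the right. [folklore] -/
theorem tensor_add_right (f g g' : WordSeries S B) :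
    tensor f (g + g') = tensor f g + tensor f g' := by
  refine WordSeries.ext fun u => WordSeries.ext fun v => ?_
  simp [mul_add]

/-- The **deshuffle coproduct** `δ f (u, v) = Σ_{w ∈ u ш v} f(w)` (dual to the shuffle product;
letters are primitive). (classical; Reutenauer 1993, Ch. 1). [folklore] -/
def delta (f : WordSeries S B) : WordSeries S (WordSeries S B) :=
  fun u v => ((MZV.shuffleWord u v).map f).sum

/-- Coefficients of `δ f`. [folklore] -/
theorem delta_apply (f : WordSeries S B) (u v : List S) :
    delta f u v = ((MZV.shuffleWord u v).map f).sum := rfl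

/-- `δ` is additive. [folklore] -/
theorem delta_add (f g : WordSeries S B) : delta (f + g) = delta f + delta g := by
  refine WordSeries.ext fun u => WordSeries.ext fun v => ?_
  change ((MZV.shuffleWord u v).map fun w => f w + g w).sum =
    ((MZV.shuffleWord u v).map f).sum + ((MZV.shuffleWord u v).map g).sum
  exact List.sum_map_add

/-- `δ 0 = 0`. [folklore] -/
@[simp] theorem delta_zero : delta (0 : WordSeries S B) = 0 := by
  refine WordSeries.ext fun u => WordSeries.ext fun v => ?_
  change ((MZV.shuffleWord u v).map fun _ => (0 : B)).sum = 0
  simp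

/-- `δ 1 = 1`. [folklore] -/
@[simp] theorem delta_one : delta (1 : WordSeries S B) = 1 := by
  refine WordSeries.ext fun u => WordSeries.ext fun v => ?_
  cases u with
  | nil => simp [delta_apply]
  | cons s u =>
    rw [delta_apply, one_cons, zero_apply]
    refine List.sum_eq_zero fun x hx => ?_
    obtain ⟨w, hw, rfl⟩ := List.mem_map.mp hx
    have hlen := MZV.length_of_mem_shuffleWord _ _ hw
    cases w with
    | nil => simp only [List.length_nil, List.length_cons] at hlen; omega
    | cons t w => rfl

/-- **`δ` is multiplicative**: `δ(fg) = δf · δg` — the bialgebra compatibility of shuffle and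
deconcatenation. (classical; Reutenauer 1993, Ch. 1). [folklore] -/
theorem delta_mul (f g : WordSeries S B) : delta (f * g) = delta f * delta g := by
  refine WordSeries.ext fun u => WordSeries.ext fun v => ?_
  have h : ((MZV.shuffleWord u v).map (f * g)).sum = shuffleCutSum (fun p q => f p * g q) u v :=
    sum_shuffleWord_cutSum (fun p q => f p * g q) u v
  rw [delta_apply, h, shuffleCutSum, mul_apply, finset_sum_apply]
  refine Finset.sum_congr rfl fun i _ => ?_
  rw [mul_apply]
  refine Finset.sum_congr rfl fun j _ => ?_
  rw [delta_apply, delta_apply, ← List.sum_map_mul_right]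
  refine congrArg List.sum (List.map_congr_left fun w₁ _ => ?_)
  rw [← List.sum_map_mul_left]

/-- `δ` as a ring homomorphism `B⟨⟨S⟩⟩ → B⟨⟨S⟩⟩ ⊗̂ B⟨⟨S⟩⟩`. [folklore] -/
def deltaHom : WordSeries S B →+* WordSeries S (WordSeries S B) where
  toFun := delta
  map_one' := delta_one
  map_mul' := delta_mul
  map_zero' := delta_zero
  map_add' := delta_add

variable [DecidableEq S]

/-- **Letters are primitive**: `δ k = k ⊗ 1 + 1 ⊗ k` (classical; Reutenauer 1993, Ch. 1).
[folklore] -/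
theorem delta_X (k : S) : delta (X k : WordSeries S B) = tensor (X k) 1 + tensor 1 (X k) := by
  refine WordSeries.ext fun u => WordSeries.ext fun v => ?_
  rw [delta_apply, add_apply, add_apply, tensor_apply, tensor_apply]
  cases u with
  | nil => simp
  | cons s u =>
    cases v with
    | nil => simp
    | cons t v =>
      rw [one_cons, one_cons, mul_zero, zero_mul, add_zero]
      refine List.sum_eq_zero fun x hx => ?_
      obtain ⟨w, hw, rfl⟩ := List.mem_map.mp hx
      have hlen := MZV.length_of_mem_shuffleWord _ _ hw
      simp only [List.length_cons] at hlen
      rw [X_apply, if_neg]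
      rintro rfl
      simp only [List.length_cons, List.length_nil] at hlen
      omega

end Delta

/-! #### Deshuffles and their duality with shuffles -/

section Deshuffle

/-- The deshuffles of a word `c`: all pairs `(c_L, c_R)` of complementary subwords, one for each
subset `L` of the positions (with multiplicity, `2^{|c|}` of them). [folklore] -/
def desh : List S → List (List S × List S)
  | [] => [([], [])]
  | k :: c => ((desh c).map fun de => (k :: de.1, de.2)) ++ (desh c).map fun de => (de.1, k :: de.2)

variable [DecidableEq S]

/-- Multiplicity of a cons in a family of conses. [folklore] -/
theorem count_map_cons (k k' : S) (c : List S) (L : Multiset (List S)) :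
    (L.map (List.cons k')).count (k :: c) = if k = k' then L.count c else 0 := by
  split_ifs with h
  · subst h
    exact Multiset.count_map_eq_count' _ L List.cons_injective c
  · exact Multiset.count_eq_zero.mpr fun hm => by
      obtain ⟨x, -, hx⟩ := Multiset.mem_map.mp hm
      exact h (List.cons.inj hx).1.symm

/-- The empty word is not a cons. [folklore] -/
theorem count_map_cons_nil (k' : S) (L : Multiset (List S)) : (L.map (List.cons k')).count [] = 0 :=
  Multiset.count_eq_zero.mpr fun hm => by
    obtain ⟨x, -, hx⟩ := Multiset.mem_map.mp hm
    exact List.cons_ne_nil _ _ hx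

/-- Multiplicity in the first family of deshuffles of `k' c`. [folklore] -/
theorem count_map_consFst (k k' : S) (d e : List S) (L : Multiset (List S × List S)) :
    (L.map fun de => (k' :: de.1, de.2)).count (k :: d, e) =
      if k = k' then L.count (d, e) else 0 := by
  split_ifs with h
  · subst h
    exact Multiset.count_map_eq_count' (fun de : List S × List S => (k :: de.1, de.2)) L
      (fun x y hxy => by
        simp only [Prod.mk.injEq, List.cons.injEq, true_and] at hxy
        exact Prod.ext hxy.1 hxy.2) (d, e)
  · exact Multiset.count_eq_zero.mpr fun hm => by
      obtain ⟨x, -, hx⟩ := Multiset.mem_map.mp hm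
      simp only [Prod.mk.injEq, List.cons.injEq] at hx
      exact h hx.1.1.symm

/-- The first family of deshuffles of `k' c` has non-empty first components. [folklore] -/
theorem count_map_consFst_nil (k' : S) (e : List S) (L : Multiset (List S × List S)) :
    (L.map fun de => (k' :: de.1, de.2)).count ([], e) = 0 :=
  Multiset.count_eq_zero.mpr fun hm => by
    obtain ⟨x, -, hx⟩ := Multiset.mem_map.mp hm
    simp at hx

/-- Multiplicity in the second family of deshuffles of `k' c`. [folklore] -/
theorem count_map_consSnd (k k' : S) (d e : List S) (L : Multiset (List S × List S)) :
    (L.map fun de => (de.1, k' :: de.2)).count (d, k :: e) =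
      if k = k' then L.count (d, e) else 0 := by
  split_ifs with h
  · subst h
    exact Multiset.count_map_eq_count' (fun de : List S × List S => (de.1, k :: de.2)) L
      (fun x y hxy => by
        simp only [Prod.mk.injEq, List.cons.injEq, true_and] at hxy
        exact Prod.ext hxy.1 hxy.2) (d, e)
  · exact Multiset.count_eq_zero.mpr fun hm => by
      obtain ⟨x, -, hx⟩ := Multiset.mem_map.mp hm
      simp only [Prod.mk.injEq, List.cons.injEq] at hx
      exact h hx.2.1.symm

/-- The second family of deshuffles of `k' c` has non-empty second components. [folklore] -/
theorem count_map_consSnd_nil (k' : S) (d : List S) (L : Multiset (List S × List S)) :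
    (L.map fun de => (de.1, k' :: de.2)).count (d, []) = 0 :=
  Multiset.count_eq_zero.mpr fun hm => by
    obtain ⟨x, -, hx⟩ := Multiset.mem_map.mp hm
    simp at hx

/-- **Deshuffle/shuffle duality**: the multiplicity of `(d, e)` among the deshuffles of `c` is
the multiplicity of `c` in the shuffle product `d ш e` (the deshuffle coproduct is the transpose of
the shuffle product in the basis of words). (classical; Reutenauer 1993, Ch. 1). [folklore] -/
theorem count_desh : ∀ (c d e : List S),
    (desh c : Multiset (List S × List S)).count (d, e) =
      (MZV.shuffleWord d e : Multiset (List S)).count c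
  | [], d, e => by
    cases d with
    | nil =>
      cases e with
      | nil => simp [desh]
      | cons y e => simp [desh]
    | cons x d =>
      cases e with
      | nil => simp [desh]
      | cons y e =>
        rw [MZV.shuffleWord_cons_cons, ← Multiset.coe_add, Multiset.count_add, ← Multiset.map_coe,
          ← Multiset.map_coe, count_map_cons_nil, count_map_cons_nil]
        simp [desh]
  | k :: c, d, e => by
    rw [desh, ← Multiset.coe_add, Multiset.count_add, ← Multiset.map_coe, ← Multiset.map_coe]
    cases d with
    | nil =>
      cases e with
      | nil => simp
      | cons y e =>
        rw [count_map_consFst_nil, count_map_consSnd, count_desh c [] e, MZV.shuffleWord_nil_left,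
          MZV.shuffleWord_nil_left, zero_add, Multiset.coe_singleton, Multiset.coe_singleton,
          Multiset.count_singleton, Multiset.count_singleton]
        by_cases hy : y = k
        · subst hy
          by_cases he : e = c
          · subst he; simp
          · simp [Ne.symm he]
        · simp [hy, Ne.symm hy]
    | cons x d =>
      cases e with
      | nil =>
        rw [count_map_consSnd_nil, count_map_consFst, count_desh c d [], MZV.shuffleWord_nil_right,
          MZV.shuffleWord_nil_right, add_zero, Multiset.coe_singleton, Multiset.coe_singleton,
          Multiset.count_singleton, Multiset.count_singleton]
        by_cases hx : x = k
        · subst hx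
          by_cases hd : d = c
          · subst hd; simp
          · simp [Ne.symm hd]
        · simp [hx, Ne.symm hx]
      | cons y e =>
        rw [count_map_consFst, count_map_consSnd, count_desh c d (y :: e), count_desh c (x :: d) e,
          MZV.shuffleWord_cons_cons, ← Multiset.coe_add, Multiset.count_add, ← Multiset.map_coe,
          ← Multiset.map_coe, count_map_cons, count_map_cons]
        simp only [eq_comm]

/-- `count_desh` for a pair variable. [folklore] -/
theorem count_desh' (c : List S) (de : List S × List S) :
    (desh c : Multiset (List S × List S)).count de =
      (MZV.shuffleWord de.1 de.2 : Multiset (List S)).count c :=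
  count_desh c de.1 de.2

/-- A list sum as a finite sum weighted by multiplicities. [folklore] -/
theorem list_map_sum_eq_sum_count {α M : Type*} [DecidableEq α] [AddCommMonoid M] (l : List α)
    (g : α → M) : (l.map g).sum = ∑ m ∈ l.toFinset, (l : Multiset α).count m • g m := by
  have h := Finset.sum_multiset_map_count (l : Multiset α) g
  rwa [Multiset.map_coe, Multiset.sum_coe] at h

end Deshuffle

end WordSeries

/-! ### Families of "iterated integrals" and their generating series -/

section Families

variable {S : Type u} {B : Type v}

open WordSeries

/-- The generating series `Φ^K_{a,b} = Σ_w K(a; w; b)·w` of a family `K(a; w; b) ∈ B`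
(Goncharov: `F(p_{a,b})`, the image of the generator `p_{a,b}` of the path algebra under the
automorphism `F` with coordinates `I_{a,w,b}(F) = K(a; w; b)`). [cite: Goncharov2005, Thm 2.5] -/
def phi (K : S → List S → S → B) (a b : S) : WordSeries S B := fun w => K a w b

/-- Coefficients of `Φ^K_{a,b}`. [folklore] -/
@[simp] theorem phi_apply (K : S → List S → S → B) (a b : S) (w : List S) : phi K a b w = K a w b :=
  rfl

variable [CommRing B] [DecidableEq S]

/-- `Ψ^K(a; c₁…c_k; b) = Φ_{a,c₁}·c₁·Φ_{c₁,c₂}·c₂ ⋯ c_k·Φ_{c_k,b}`: the image `F(p_{a,c₁,…,c_k,b})`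
of the path `p_{a,c₁,…,c_k,b} = p_{a,c₁} ∗ ⋯ ∗ p_{c_k,b}` under the `∗`-homomorphism `F`,
`F(p_{a,b}) = Φ_{a,b}`
(proof of Thm 2.5: "`F` … is uniquely determined by its values on the generators `p_{a,b}`"). Its
coefficients are the right-hand factors `∏_p 𝕀(a_{i_p}; …; a_{i_{p+1}})` of Goncharov's coproduct
(`sum_splittings_eq_sum_psiF`). [cite: Goncharov2005, Thm 2.5] -/
def psi (K : S → List S → S → B) : S → List S → S → WordSeries S B
  | a, [], b => phi K a b
  | a, k :: c, b => phi K a k * X k * psi K k c b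

/-- `Ψ(a; ∅; b) = Φ_{a,b}`. [folklore] -/
@[simp] theorem psi_nil (K : S → List S → S → B) (a b : S) : psi K a [] b = phi K a b := rfl

/-- `Ψ(a; k c; b) = Φ_{a,k} k Ψ(k; c; b)`. [folklore] -/
@[simp] theorem psi_cons (K : S → List S → S → B) (a k : S) (c : List S) (b : S) :
    psi K a (k :: c) b = phi K a k * X k * psi K k c b := rfl

/-- Path composition (iii) in series form, `Φ_{a,x}Φ_{x,b} = Φ_{a,b}` ("iii) is equivalent to
`F(p_{a,b}) = F(p_{a,x}) ∘ F(p_{x,b})`"), propagates to `Φ_{a,x} Ψ(x; c; b) = Ψ(a; c; b)`.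
[cite: Goncharov2005, Thm 2.5] -/
theorem phi_mul_psi {K : S → List S → S → B} (hK : ∀ a y b, phi K a y * phi K y b = phi K a b)
    (a x : S) : ∀ (c : List S) (b : S), phi K a x * psi K x c b = psi K a c b
  | [], b => hK a x b
  | k :: c, b => by rw [psi_cons, psi_cons, ← mul_assoc, ← mul_assoc, hK]

/-- `F` preserves the `∘`-product on all paths once it does on generators:
`Ψ(a; c; x) Ψ(x; c'; b) = Ψ(a; c c'; b)`. [cite: Goncharov2005, Thm 2.5] -/
theorem psi_mul_psi {K : S → List S → S → B} (hK : ∀ a y b, phi K a y * phi K y b = phi K a b)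
    (x b : S) (c' : List S) :
    ∀ (c : List S) (a : S), psi K a c x * psi K x c' b = psi K a (c ++ c') b
  | [], a => phi_mul_psi hK a x c' b
  | k :: c, a => by
    rw [List.cons_append, psi_cons, psi_cons, mul_assoc (phi K a k * X k),
      psi_mul_psi hK x b c' c k]

/-- A coefficient of `f·k·g` at `w` is non-zero only if `w = w₁ k w₂` with `g(w₂) ≠ 0`.
[folklore] -/
theorem mul_X_mul_apply_ne_zero {c : List S} {k : S} {g : WordSeries S B}
    (hg : ∀ w, g w ≠ 0 → List.Sublist c w) :
    ∀ (f : WordSeries S B) (w : List S),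
      (f * X k * g : WordSeries S B) w ≠ 0 → List.Sublist (k :: c) w := by
  intro f w
  induction w generalizing f with
  | nil => intro h; exact absurd (mul_X_mul_apply_nil f k g) h
  | cons s w ih =>
    intro h
    rw [mul_X_mul_apply_cons] at h
    by_cases h2 : (shift s f * X k * g : WordSeries S B) w = 0
    · rw [h2, add_zero] at h
      split_ifs at h with hs
      · subst hs
        exact List.cons_sublist_cons.mpr (hg w (right_ne_zero_of_mul h))
      · exact absurd rfl h
    · exact (ih (shift s f) h2).cons s

/-- **Triangularity**: `Ψ(a; c; b)` is supported on words containing `c` as a subword.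
[folklore] -/
theorem psi_apply_ne_zero (K : S → List S → S → B) :
    ∀ (c : List S) (a b : S) (w : List S), psi K a c b w ≠ 0 → List.Sublist c w
  | [], _, _, w, _ => List.nil_sublist w
  | k :: c, _, b, w, h =>
    mul_X_mul_apply_ne_zero (fun w' h' => psi_apply_ne_zero K c k b w' h') _ w h

/-- Triangularity, contrapositive. [folklore] -/
theorem psi_apply_eq_zero (K : S → List S → S → B) {c : List S} {a b : S} {w : List S}
    (h : ¬List.Sublist c w) : psi K a c b w = 0 :=
  by_contra fun h' => h (psi_apply_ne_zero K c a b w h')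

/-- **`F` commutes with `δ` on all paths once it does on generators**: if every `Φ_{a,b}` is
group-like (`δΦ = Φ ⊗ Φ`, i.e. the shuffle relation (ii)) and (iii) holds, then
`δΨ(a; c; b) = Σ_{(d,e) deshuffle of c} Ψ(a; d; b) ⊗ Ψ(a; e; b)` (letters being primitive).
[cite: Goncharov2005, Thm 2.5] -/
theorem delta_psi {K : S → List S → S → B}
    (hKii : ∀ a b, delta (phi K a b) = tensor (phi K a b) (phi K a b))
    (hKiii : ∀ a y b, phi K a y * phi K y b = phi K a b) :
    ∀ (c : List S) (a b : S), delta (psi K a c b) =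
      ((desh c).map fun de => tensor (psi K a de.1 b) (psi K a de.2 b)).sum
  | [], a, b => by simp [desh, hKii]
  | k :: c, a, b => by
    rw [psi_cons, delta_mul, delta_mul, delta_X, hKii, delta_psi hKii hKiii c k b, desh,
      List.map_append, List.sum_append, List.map_map, List.map_map, mul_add, add_mul]
    simp only [← List.sum_map_mul_left, Function.comp_def, tensor_mul_tensor, mul_one,
      phi_mul_psi hKiii, psi_cons]

/-! ### The contraction `Σ_c φ(c) Ω(c)` -/

/-- The finite set of subwords of `w`. [folklore] -/
def subwords (w : List S) : Finset (List S) := w.sublists.toFinset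

/-- Membership in `subwords`. [folklore] -/
theorem mem_subwords {c w : List S} : c ∈ subwords w ↔ List.Sublist c w := by
  simp [subwords]

/-- `subwords` is monotone for the subword order. [folklore] -/
theorem subwords_mono {w w' : List S} (h : List.Sublist w w') : subwords w ⊆ subwords w' :=
  fun _ hc => mem_subwords.2 ((mem_subwords.1 hc).trans h)

/-- The **contraction** `⟨φ, Ω⟩ = Σ_c φ(c)·Ω(c)` of a weight `φ` on words against a family of series
`Ω(c)` supported on words containing `c` (so that every coefficient is a finite sum, over the
subwords of the target word). With `φ = 𝕀(a; ·; b) ⊗ 1` and `Ω = Ψ^{1 ⊗ 𝕀}(a; ·; b)` this is the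
generating series of Goncharov's `Δ𝕀(a; w; b)` (`conv_eq_contr`). [folklore] -/
def contr (φ : WordSeries S B) (Ω : List S → WordSeries S B) : WordSeries S B :=
  fun w => ∑ c ∈ subwords w, φ c * Ω c w

/-- Coefficients of a contraction. [folklore] -/
theorem contr_apply (φ : WordSeries S B) (Ω : List S → WordSeries S B) (w : List S) :
    contr φ Ω w = ∑ c ∈ subwords w, φ c * Ω c w := rfl

/-- A contraction against a triangular family may be summed over any larger finite set.
[folklore] -/
theorem contr_apply_eq_sum_of_subset (φ : WordSeries S B) {Ω : List S → WordSeries S B}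
    (hΩ : ∀ c w, Ω c w ≠ 0 → List.Sublist c w) {w : List S} {F : Finset (List S)}
    (hF : subwords w ⊆ F) :
    contr φ Ω w = ∑ c ∈ F, φ c * Ω c w := by
  refine Finset.sum_subset hF fun c _ hc => ?_
  rw [show Ω c w = 0 from by_contra fun h => hc (mem_subwords.2 (hΩ c w h)), mul_zero]

/-- **Product of contractions**: `⟨φ, Ω₁⟩·⟨φ', Ω₂⟩ = ⟨φ, d ↦ ⟨φ', e ↦ Ω₁(d)Ω₂(e)⟩⟩`. [folklore] -/
theorem contr_mul_contr (φ φ' : WordSeries S B) {Ω₁ Ω₂ : List S → WordSeries S B}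
    (hΩ₁ : ∀ c w, Ω₁ c w ≠ 0 → List.Sublist c w) (hΩ₂ : ∀ c w, Ω₂ c w ≠ 0 → List.Sublist c w) :
    contr φ Ω₁ * contr φ' Ω₂ = contr φ fun d => contr φ' fun e => Ω₁ d * Ω₂ e := by
  ext w
  rw [mul_apply, contr_apply]
  have h1 : ∀ k, contr φ Ω₁ (w.take k) = ∑ d ∈ subwords w, φ d * Ω₁ d (w.take k) := fun k =>
    contr_apply_eq_sum_of_subset φ hΩ₁ (subwords_mono (List.take_sublist k w))
  have h2 : ∀ k, contr φ' Ω₂ (w.drop k) = ∑ e ∈ subwords w, φ' e * Ω₂ e (w.drop k) := fun k =>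
    contr_apply_eq_sum_of_subset φ' hΩ₂ (subwords_mono (List.drop_sublist k w))
  simp_rw [h1, h2, Finset.sum_mul_sum]
  rw [Finset.sum_comm]
  refine Finset.sum_congr rfl fun d _ => ?_
  rw [contr_apply, Finset.mul_sum, Finset.sum_comm]
  refine Finset.sum_congr rfl fun e _ => ?_
  rw [mul_apply, Finset.mul_sum, Finset.mul_sum]
  refine Finset.sum_congr rfl fun k _ => ?_
  ring

/-- **Contraction of a Cauchy product**: `⟨φφ', Ω⟩ = ⟨φ, d ↦ ⟨φ', e ↦ Ω(de)⟩⟩` (regrouping the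
cuts of the contracted word). [folklore] -/
theorem contr_mul (φ φ' : WordSeries S B) {Ω : List S → WordSeries S B}
    (hΩ : ∀ c w, Ω c w ≠ 0 → List.Sublist c w) :
    contr (φ * φ') Ω = contr φ fun d => contr φ' fun e => Ω (d ++ e) := by
  ext w
  simp only [contr_apply, mul_apply, Finset.sum_mul, Finset.mul_sum]
  rw [Finset.sum_sigma', Finset.sum_sigma']
  trans ∑ y ∈ ((subwords w).sigma fun _ => subwords w).filter
      (fun y => List.Sublist (y.1 ++ y.2) w), φ y.1 * (φ' y.2 * Ω (y.1 ++ y.2) w)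
  · refine Finset.sum_nbij' (fun x => ⟨x.1.take x.2, x.1.drop x.2⟩)
      (fun y => ⟨y.1 ++ y.2, y.1.length⟩) ?_ ?_ ?_ ?_ ?_
    · rintro ⟨c, j⟩ hx
      simp only [Finset.mem_sigma, Finset.mem_range, mem_subwords] at hx
      simp only [Finset.mem_filter, Finset.mem_sigma, mem_subwords,
        List.take_append_drop]
      exact ⟨⟨(List.take_sublist j c).trans hx.1, (List.drop_sublist j c).trans hx.1⟩, hx.1⟩
    · rintro ⟨d, e⟩ hy
      simp only [Finset.mem_filter, Finset.mem_sigma, mem_subwords] at hy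
      simp only [Finset.mem_sigma, Finset.mem_range, mem_subwords,
        List.length_append]
      exact ⟨hy.2, by omega⟩
    · rintro ⟨c, j⟩ hx
      simp only [Finset.mem_sigma, Finset.mem_range, mem_subwords] at hx
      have hj : (c.take j).length = j := by rw [List.length_take]; omega
      simp only [List.take_append_drop, hj]
    · rintro ⟨d, e⟩ -
      simp
    · rintro ⟨c, j⟩ -
      simp only [List.take_append_drop, mul_assoc]
  · refine Finset.sum_filter_of_ne fun y _ hy => by_contra fun h => hy ?_
    rw [show Ω (y.1 ++ y.2) w = 0 from by_contra fun h' => h (hΩ _ _ h'), mul_zero, mul_zero]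

/-! ### The coefficients of `⟨φ, Ψ⟩` are Goncharov's sums over splittings -/

/-- The right-hand factor `∏_p K(a_{i_p}; a_{i_p+1}…a_{i_{p+1}-1}; a_{i_{p+1}})` of Goncharov's
coproduct for a splitting, with values in a family `K` (`gapProd` is the case `K = gen`).
[cite: Goncharov2005, §2.1] -/
def gapProdF (K : S → List S → S → B) : S → List S → List (S × List S) → S → B
  | x, g, [], b => K x g b
  | x, g, p :: ps, b => K x g p.1 * gapProdF K p.1 p.2 ps b

/-- `gapProdF` with the first gap evaluated through auxiliary series `F y` (the value on a first
gap `g` ending at `y` is `F y g`; needed to recurse on the word from the left). [folklore] -/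
def gapProdF' (F : S → WordSeries S B) (K : S → List S → S → B) :
    List S → List (S × List S) → S → B
  | g, [], b => F b g
  | g, p :: ps, b => F p.1 g * gapProdF K p.1 p.2 ps b

omit [DecidableEq S] in
/-- `gapProdF` is `gapProdF'` with `F = Φ^K_{x,·}`. [folklore] -/
theorem gapProdF_eq_gapProdF' (K : S → List S → S → B) (x : S) (g : List S)
    (ps : List (S × List S)) (b : S) :
    gapProdF K x g ps b = gapProdF' (fun y => phi K x y) K g ps b := by
  cases ps <;> rfl

omit [DecidableEq S] in
/-- Prepending a letter to the first gap shifts the auxiliary series. [folklore] -/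
theorem gapProdF'_cons (F : S → WordSeries S B) (K : S → List S → S → B) (s : S) (g : List S)
    (ps : List (S × List S)) (b : S) :
    gapProdF' F K (s :: g) ps b = gapProdF' (fun y => shift s (F y)) K g ps b := by
  cases ps <;> rfl

/-- `Ψ` with the first factor `Φ_{a,·}` replaced by auxiliary series `F ·`. [folklore] -/
def psiF (F : S → WordSeries S B) (K : S → List S → S → B) : List S → S → WordSeries S B
  | [], b => F b
  | k :: c, b => F k * X k * psi K k c b

/-- `Ψ(a; c; b)` is `psiF` with `F = Φ^K_{a,·}`. [folklore] -/
theorem psi_eq_psiF (K : S → List S → S → B) (a : S) (c : List S) (b : S) :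
    psi K a c b = psiF (fun y => phi K a y) K c b := by
  cases c <;> rfl

/-- Triangularity of `psiF`. [folklore] -/
theorem psiF_apply_ne_zero (F : S → WordSeries S B) (K : S → List S → S → B) :
    ∀ (c : List S) (b : S) (w : List S), psiF F K c b w ≠ 0 → List.Sublist c w
  | [], _, w, _ => List.nil_sublist w
  | k :: c, b, w, h => mul_X_mul_apply_ne_zero (fun w' h' => psi_apply_ne_zero K c k b w' h') _ w h

/-- The correction term in the recursion of `psiF` on the target word: the first letter `s` of
the target is the first kept letter. [folklore] -/
def headTerm (F : S → WordSeries S B) (K : S → List S → S → B) (s b : S) (w : List S) :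
    List S → B
  | [] => 0
  | k :: c => if s = k then F k [] * psi K k c b w else 0

/-- `headTerm` at the empty kept word. [folklore] -/
@[simp] theorem headTerm_nil (F : S → WordSeries S B) (K : S → List S → S → B) (s b : S)
    (w : List S) : headTerm F K s b w [] = 0 := rfl

/-- `headTerm` at a non-empty kept word. [folklore] -/
theorem headTerm_cons (F : S → WordSeries S B) (K : S → List S → S → B) (s b : S)
    (w : List S) (k : S) (c : List S) :
    headTerm F K s b w (k :: c) = if s = k then F k [] * psi K k c b w else 0 := rfl

/-- `headTerm` at a kept word starting with the target's first letter. [folklore] -/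
@[simp] theorem headTerm_cons_self (F : S → WordSeries S B) (K : S → List S → S → B) (s b : S)
    (w c : List S) : headTerm F K s b w (s :: c) = F s [] * psi K s c b w := if_pos rfl

/-- `headTerm` at a kept word not starting with the target's first letter. [folklore] -/
theorem headTerm_cons_of_ne (F : S → WordSeries S B) (K : S → List S → S → B) {s k : S} (b : S)
    (w c : List S) (h : s ≠ k) : headTerm F K s b w (k :: c) = 0 := if_neg h

/-- Recursion of `psiF` on the target word. [folklore] -/
theorem psiF_apply_cons (F : S → WordSeries S B) (K : S → List S → S → B) (c : List S) (b s : S)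
    (w : List S) :
    psiF F K c b (s :: w) = headTerm F K s b w c + psiF (fun y => shift s (F y)) K c b w := by
  cases c with
  | nil => rw [headTerm_nil, zero_add]; rfl
  | cons k c =>
    rw [headTerm_cons]
    exact mul_X_mul_apply_cons (F k) k (psi K k c b) s w

/-- **Goncharov's sum over splittings is a contraction coefficient**:
`Σ_{splittings p of w} φ(kept p) · ∏(gaps of p through F, K) = Σ_{c ⊆ w} φ(c) · psiF F K c b (w)`.
[cite: Goncharov2005, §2.1] -/
theorem sum_splittings_eq_sum_psiF (K : S → List S → S → B) (b : S) :
    ∀ (w : List S) (F : S → WordSeries S B) (φ : List S → B),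
      ((splittings w).map fun p => φ (p.2.map Prod.fst) * gapProdF' F K p.1 p.2 b).sum =
        ∑ c ∈ subwords w, φ c * psiF F K c b w
  | [], F, φ => by simp [splittings, gapProdF', psiF, subwords]
  | s :: w, F, φ => by
    have ih₁ := sum_splittings_eq_sum_psiF K b w (fun y => shift s (F y)) φ
    have ih₂ := sum_splittings_eq_sum_psiF K b w (fun y => phi K s y) fun c => φ (s :: c)
    rw [splittings, List.map_append, List.sum_append, List.map_map, List.map_map]
    have e₁ : ((splittings w).map ((fun p : List S × List (S × List S) =>
        φ (p.2.map Prod.fst) * gapProdF' F K p.1 p.2 b) ∘ fun p => (s :: p.1, p.2))).sum =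
        ∑ c ∈ subwords w, φ c * psiF (fun y => shift s (F y)) K c b w := by
      rw [← ih₁]
      exact congrArg List.sum (List.map_congr_left fun p _ => by
        simp only [Function.comp_apply, gapProdF'_cons])
    have e₂ : ((splittings w).map ((fun p : List S × List (S × List S) =>
        φ (p.2.map Prod.fst) * gapProdF' F K p.1 p.2 b) ∘ fun p =>
          (([] : List S), (s, p.1) :: p.2))).sum =
        F s [] * ∑ c ∈ subwords w, φ (s :: c) * psi K s c b w := by
      simp_rw [psi_eq_psiF]
      rw [← ih₂, ← List.sum_map_mul_left]
      exact congrArg List.sum (List.map_congr_left fun p _ => by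
        simp only [Function.comp_apply, List.map_cons]
        rw [gapProdF', gapProdF_eq_gapProdF']
        ring)
    have e₃ : ∑ c ∈ subwords (s :: w), φ c * psiF F K c b (s :: w) =
        ∑ c ∈ subwords (s :: w), φ c * psiF (fun y => shift s (F y)) K c b w +
          ∑ c ∈ subwords (s :: w), φ c * headTerm F K s b w c := by
      rw [← Finset.sum_add_distrib]
      exact Finset.sum_congr rfl fun c _ => by rw [psiF_apply_cons, mul_add, add_comm]
    have e₄ : ∑ c ∈ subwords (s :: w), φ c * psiF (fun y => shift s (F y)) K c b w =
        ∑ c ∈ subwords w, φ c * psiF (fun y => shift s (F y)) K c b w := by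
      symm
      refine Finset.sum_subset (subwords_mono (List.sublist_cons_self s w)) fun c _ hc => ?_
      rw [show psiF _ K c b w = 0 from
        by_contra fun h => hc (mem_subwords.2 (psiF_apply_ne_zero _ K c b w h)), mul_zero]
    have e₅ : ∑ c ∈ subwords (s :: w), φ c * headTerm F K s b w c =
        ∑ c ∈ subwords w, φ (s :: c) * (F s [] * psi K s c b w) := by
      have hsub : (subwords w).map ⟨List.cons s, List.cons_injective⟩ ⊆ subwords (s :: w) := by
        intro c hc
        obtain ⟨c', hc', rfl⟩ := Finset.mem_map.1 hc
        exact mem_subwords.2 (List.cons_sublist_cons.2 (mem_subwords.1 hc'))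
      rw [← Finset.sum_subset hsub ?_, Finset.sum_map]
      · exact Finset.sum_congr rfl fun c _ => by simp
      · intro c hc hc'
        cases c with
        | nil => simp
        | cons k c =>
          by_cases hk : s = k
          · subst hk
            exact absurd (Finset.mem_map.2
              ⟨c, mem_subwords.2 (List.cons_sublist_cons.1 (mem_subwords.1 hc)), rfl⟩) hc'
          · rw [headTerm_cons_of_ne F K b w c hk, mul_zero]
    rw [e₁, e₂, e₃, e₄, e₅, Finset.mul_sum]
    refine congrArg _ (Finset.sum_congr rfl fun c _ => ?_)
    ring

/-! ### Goncharov's coproduct on families, and its compatibility with (ii) and (iii) -/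

/-- **Goncharov's coproduct formula on families**:
`conv J K (a; w; b) = Σ_{0<i₁<⋯<i_k<m+1} J(a; a_{i₁}…a_{i_k}; b) · ∏_p K(a_{i_p}; …; a_{i_{p+1}})`,
i.e. `Δ𝕀(a; w; b)` with the left tensor factor read in `J` and the right one in `K`
(`map_coproductFree_gen`). In terms of automorphisms of the path algebra this is the coordinate
of the composite `F_K`-then-`F_J`. [cite: Goncharov2005, §2.1] -/
def conv (J K : S → List S → S → B) (a : S) (w : List S) (b : S) : B :=
  ((splittings w).map fun p => J a (p.2.map Prod.fst) b * gapProdF K a p.1 p.2 b).sum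

/-- The generating series of `conv J K (a; ·; b)` is the contraction `⟨Φ^J_{a,b}, Ψ^K(a; ·; b)⟩`.
[cite: Goncharov2005, Thm 2.5] -/
theorem conv_eq_contr (J K : S → List S → S → B) (a : S) (w : List S) (b : S) :
    conv J K a w b = contr (phi J a b) (fun c => psi K a c b) w := by
  rw [contr_apply, conv]
  simp_rw [gapProdF_eq_gapProdF', psi_eq_psiF]
  exact sum_splittings_eq_sum_psiF K b w (fun y => phi K a y) fun c => J a c b

/-- **`Δ` respects the path composition formula (iii)**: if `J` and `K` satisfy (iii), so does
`conv J K` (automorphisms preserving the `∘`-product compose). [cite: Goncharov2005, Prop 2.2] -/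
theorem conv_path {J K : S → List S → S → B} (hJ : ∀ a y b, phi J a y * phi J y b = phi J a b)
    (hK : ∀ a y b, phi K a y * phi K y b = phi K a b) (a x b : S) (w : List S) :
    conv J K a w b =
      ∑ k ∈ Finset.range (w.length + 1), conv J K a (w.take k) x * conv J K x (w.drop k) b := by
  have key : contr (phi J a b) (fun c => psi K a c b) =
      contr (phi J a x) (fun c => psi K a c x) * contr (phi J x b) (fun c => psi K x c b) := by
    rw [contr_mul_contr _ _ (fun c w => psi_apply_ne_zero K c a x w)
      (fun c w => psi_apply_ne_zero K c x b w)]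
    simp_rw [psi_mul_psi hK]
    rw [← contr_mul _ _ (fun c w => psi_apply_ne_zero K c a b w), hJ]
  simp_rw [conv_eq_contr]
  rw [key, mul_apply]

/-- Swapping a list sum with a finite sum. [folklore] -/
theorem list_sum_map_finset_sum {ι κ M : Type*} [AddCommMonoid M] (L : List ι) (F : Finset κ)
    (g : κ → ι → M) :
    (L.map fun w => ∑ c ∈ F, g c w).sum = ∑ c ∈ F, (L.map fun w => g c w).sum := by
  induction L with
  | nil => simp
  | cons x L ih => simp [ih, Finset.sum_add_distrib]

/-- Two finite sums agree if the summand vanishes off the intersection of the ranges.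
[folklore] -/
theorem sum_eq_sum_of_vanish {ι M : Type*} [DecidableEq ι] [AddCommMonoid M] {A C : Finset ι}
    {f : ι → M} (hA : ∀ x ∈ A, x ∉ C → f x = 0) (hC : ∀ x ∈ C, x ∉ A → f x = 0) :
    ∑ x ∈ A, f x = ∑ x ∈ C, f x := by
  have hAU : ∑ x ∈ A, f x = ∑ x ∈ A ∪ C, f x :=
    Finset.sum_subset Finset.subset_union_left fun x hx hxA => by
      rcases Finset.mem_union.1 hx with h | h
      · exact absurd h hxA
      · exact hC x h hxA
  have hCU : ∑ x ∈ C, f x = ∑ x ∈ A ∪ C, f x :=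
    Finset.sum_subset Finset.subset_union_right fun x hx hxC => by
      rcases Finset.mem_union.1 hx with h | h
      · exact hA x h hxC
      · exact absurd h hxC
  rw [hAU, hCU]

/-- **`Δ` respects the shuffle product formula (ii)**: if `J` satisfies (ii) and `K` satisfies
(ii) and (iii), then `conv J K` satisfies (ii) (automorphisms commuting with `δ` compose; the
proof contracts the deshuffle/shuffle duality `count_desh` against (ii) for `J`).
[cite: Goncharov2005, Prop 2.2] -/
theorem conv_shuffle {J K : S → List S → S → B}
    (hJii : ∀ a b u v, J a u b * J a v b = ((MZV.shuffleWord u v).map fun w => J a w b).sum)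
    (hKii : ∀ a b, delta (phi K a b) = tensor (phi K a b) (phi K a b))
    (hKiii : ∀ a y b, phi K a y * phi K y b = phi K a b) (a b : S) (u v : List S) :
    conv J K a u b * conv J K a v b = ((MZV.shuffleWord u v).map fun w => conv J K a w b).sum := by
  simp_rw [conv_eq_contr]
  set φ : WordSeries S B := phi J a b with hφ
  set Ω : List S → WordSeries S B := fun c => psi K a c b with hΩ'
  have hΩ : ∀ c w, Ω c w ≠ 0 → List.Sublist c w := fun c w => psi_apply_ne_zero K c a b w
  set D : Finset (List S × List S) := subwords u ×ˢ subwords v with hD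
  set F : Finset (List S) := ((MZV.shuffleWord u v).toFinset.biUnion subwords) ∪
    D.biUnion (fun de => (MZV.shuffleWord de.1 de.2).toFinset) with hF
  -- the shuffle side
  have h1 : ((MZV.shuffleWord u v).map fun w => contr φ Ω w).sum =
      ∑ c ∈ F, φ c * delta (Ω c) u v := by
    calc ((MZV.shuffleWord u v).map fun w => contr φ Ω w).sum
        = ((MZV.shuffleWord u v).map fun w => ∑ c ∈ F, φ c * Ω c w).sum := by
          refine congrArg List.sum (List.map_congr_left fun w hw => ?_)
          exact contr_apply_eq_sum_of_subset φ hΩ (Finset.subset_union_left.trans'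
            (Finset.subset_biUnion_of_mem subwords (List.mem_toFinset.2 hw)))
      _ = ∑ c ∈ F, ((MZV.shuffleWord u v).map fun w => φ c * Ω c w).sum :=
          list_sum_map_finset_sum _ _ _
      _ = ∑ c ∈ F, φ c * delta (Ω c) u v := by
          simp_rw [List.sum_map_mul_left, delta_apply]
  have h2 : ∀ c, delta (Ω c) u v =
      ((desh c).map fun de => Ω de.1 u * Ω de.2 v).sum := fun c => by
    rw [hΩ', delta_psi hKii hKiii c a b, list_sum_apply, list_sum_apply, List.map_map,
      List.map_map]
    rfl
  have h3 : ∀ c, ((desh c).map fun de => Ω de.1 u * Ω de.2 v).sum =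
      ∑ de ∈ D, (desh c : Multiset (List S × List S)).count de • (Ω de.1 u * Ω de.2 v) := by
    intro c
    rw [list_map_sum_eq_sum_count]
    refine sum_eq_sum_of_vanish
      (f := fun de => (desh c : Multiset (List S × List S)).count de • (Ω de.1 u * Ω de.2 v))
      (fun de _ hde => ?_) (fun de _ hde => ?_)
    · rw [hD, Finset.mem_product, mem_subwords, mem_subwords, not_and_or] at hde
      rcases hde with h | h
      · rw [show Ω de.1 u = 0 from psi_apply_eq_zero K h, zero_mul, smul_zero]
      · rw [show Ω de.2 v = 0 from psi_apply_eq_zero K h, mul_zero, smul_zero]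
    · rw [Multiset.count_eq_zero.mpr (fun h => hde (List.mem_toFinset.2 (Multiset.mem_coe.1 h))),
        zero_smul]
  -- the tensor side
  have h4 : ∀ de ∈ D, ((MZV.shuffleWord de.1 de.2).map φ).sum * (Ω de.1 u * Ω de.2 v) =
      ∑ c ∈ F, (MZV.shuffleWord de.1 de.2 : Multiset (List S)).count c •
        (φ c * (Ω de.1 u * Ω de.2 v)) := by
    intro de hde
    rw [← List.sum_map_mul_right, list_map_sum_eq_sum_count]
    refine Finset.sum_subset
      (f := fun c => (MZV.shuffleWord de.1 de.2 : Multiset (List S)).count c •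
        (φ c * (Ω de.1 u * Ω de.2 v)))
      (fun c hc => ?_) fun c _ hc => ?_
    · exact Finset.mem_union_right _ (Finset.mem_biUnion.2 ⟨de, hde, hc⟩)
    · rw [Multiset.count_eq_zero.mpr (fun h => hc (List.mem_toFinset.2 (Multiset.mem_coe.1 h))),
        zero_smul]
  calc contr φ Ω u * contr φ Ω v
      = ∑ d ∈ subwords u, ∑ e ∈ subwords v, (φ d * φ e) * (Ω d u * Ω e v) := by
        rw [contr_apply, contr_apply, Finset.sum_mul_sum]
        exact Finset.sum_congr rfl fun d _ => Finset.sum_congr rfl fun e _ => by ring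
    _ = ∑ de ∈ D, ((MZV.shuffleWord de.1 de.2).map φ).sum * (Ω de.1 u * Ω de.2 v) := by
        rw [hD, Finset.sum_product]
        exact Finset.sum_congr rfl fun d _ => Finset.sum_congr rfl fun e _ => by
          rw [hφ, phi_apply, phi_apply, hJii a b d e]
          rfl
    _ = ∑ de ∈ D, ∑ c ∈ F, (MZV.shuffleWord de.1 de.2 : Multiset (List S)).count c •
          (φ c * (Ω de.1 u * Ω de.2 v)) :=
        Finset.sum_congr rfl h4
    _ = ∑ c ∈ F, ∑ de ∈ D, (desh c : Multiset (List S × List S)).count de •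
          (φ c * (Ω de.1 u * Ω de.2 v)) := by
        rw [Finset.sum_comm]
        simp_rw [count_desh']
    _ = ∑ c ∈ F, φ c * delta (Ω c) u v := by
        refine Finset.sum_congr rfl fun c _ => ?_
        rw [h2, h3, Finset.mul_sum]
        exact Finset.sum_congr rfl fun de _ => (mul_smul_comm _ _ _).symm
    _ = ((MZV.shuffleWord u v).map fun w => contr φ Ω w).sum := h1.symm

end Families

/-! ### The descent of `Δ` to `𝓘_•(S)` -/

section Descent

variable {S : Type u}

/-- `𝓘 → 𝓘 ⊗ 𝓘`, `x ↦ x ⊗ 1`. [folklore] -/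
def inclL : GoncharovFormalIteratedIntegrals S →ₐ[ℚ]
    GoncharovFormalIteratedIntegrals S ⊗[ℚ] GoncharovFormalIteratedIntegrals S :=
  Algebra.TensorProduct.includeLeft

/-- `𝓘 → 𝓘 ⊗ 𝓘`, `x ↦ 1 ⊗ x`. [folklore] -/
def inclR : GoncharovFormalIteratedIntegrals S →ₐ[ℚ]
    GoncharovFormalIteratedIntegrals S ⊗[ℚ] GoncharovFormalIteratedIntegrals S :=
  Algebra.TensorProduct.includeRight

/-- `inclL x = x ⊗ 1`. [folklore] -/
theorem inclL_apply (x : GoncharovFormalIteratedIntegrals S) : inclL x = x ⊗ₜ[ℚ] 1 := rfl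

/-- `inclR x = 1 ⊗ x`. [folklore] -/
theorem inclR_apply (x : GoncharovFormalIteratedIntegrals S) : inclR x = 1 ⊗ₜ[ℚ] x := rfl

/-- The family `𝕀(a; w; b) ⊗ 1` in `𝓘 ⊗ 𝓘` (left tensor factor of `Δ`). [folklore] -/
def leftFam (a : S) (w : List S) (b : S) :
    GoncharovFormalIteratedIntegrals S ⊗[ℚ] GoncharovFormalIteratedIntegrals S :=
  inclL (ι a w b)

/-- The family `1 ⊗ 𝕀(a; w; b)` in `𝓘 ⊗ 𝓘` (right tensor factor of `Δ`). [folklore] -/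
def rightFam (a : S) (w : List S) (b : S) :
    GoncharovFormalIteratedIntegrals S ⊗[ℚ] GoncharovFormalIteratedIntegrals S :=
  inclR (ι a w b)

/-- The class of `gapProd` is the gap product of the classes. [folklore] -/
theorem mkQ_gapProd (b : S) : ∀ (ps : List (S × List S)) (x : S) (g : List S),
    mkQ (gapProd x g ps b) = gapProdF (fun x u y => (ι x u y : GoncharovFormalIteratedIntegrals S))
      x g ps b
  | [], _, _ => rfl
  | p :: ps, x, g => by
    rw [gapProd, gapProdF, map_mul, mkQ_gapProd b ps p.1 p.2]
    rfl

/-- `1 ⊗ (gap product) = gap product of the `1 ⊗ 𝕀`. [folklore] -/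
theorem inclR_gapProdF (b : S) : ∀ (ps : List (S × List S)) (x : S) (g : List S),
    inclR (gapProdF (fun x u y => (ι x u y : GoncharovFormalIteratedIntegrals S)) x g ps b) =
      gapProdF rightFam x g ps b
  | [], _, _ => rfl
  | p :: ps, x, g => by
    rw [gapProdF, gapProdF, map_mul, inclR_gapProdF b ps p.1 p.2]
    rfl

/-- **`(π ⊗ π) ∘ Δ` on a generator is `conv` of the two tensor families.**
[cite: Goncharov2005, §2.1] -/
theorem map_coproductFree_gen (a : S) (w : List S) (b : S) :
    Algebra.TensorProduct.map (mkQ (S := S)) (mkQ (S := S)) (coproductFree S (gen a w b)) =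
      conv leftFam rightFam a w b := by
  rw [coproductFree_gen, map_list_sum, List.map_map, conv]
  refine congrArg List.sum (List.map_congr_left fun p _ => ?_)
  rw [Function.comp_apply, Algebra.TensorProduct.map_tmul, mkQ_gapProd, ← inclR_gapProdF,
    inclR_apply, leftFam, inclL_apply, Algebra.TensorProduct.tmul_mul_tmul, mul_one, one_mul]
  rfl

/-- (ii) for the left family. [folklore] -/
theorem leftFam_shuffle (a b : S) (u v : List S) :
    leftFam a u b * leftFam a v b = ((MZV.shuffleWord u v).map fun w => leftFam a w b).sum := by
  rw [leftFam, leftFam, ← map_mul, ι_mul_ι, map_list_sum, List.map_map]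
  rfl

/-- (iii) for the left family. [folklore] -/
theorem leftFam_path (a b x : S) (w : List S) : leftFam a w b =
    ∑ k ∈ Finset.range (w.length + 1), leftFam a (w.take k) x * leftFam x (w.drop k) b := by
  rw [leftFam, ι_eq_sum_take_drop a b x w, map_sum]
  simp_rw [map_mul]
  rfl

/-- (ii) for the right family. [folklore] -/
theorem rightFam_shuffle (a b : S) (u v : List S) :
    rightFam a u b * rightFam a v b = ((MZV.shuffleWord u v).map fun w => rightFam a w b).sum := by
  rw [rightFam, rightFam, ← map_mul, ι_mul_ι, map_list_sum, List.map_map]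
  rfl

/-- (iii) for the right family. [folklore] -/
theorem rightFam_path (a b x : S) (w : List S) : rightFam a w b =
    ∑ k ∈ Finset.range (w.length + 1), rightFam a (w.take k) x * rightFam x (w.drop k) b := by
  rw [rightFam, ι_eq_sum_take_drop a b x w, map_sum]
  simp_rw [map_mul]
  rfl

open WordSeries in
/-- **Goncharov 2005, Proposition 2.2 (well-definedness of `Δ` on `𝓘_•(S)`).** The coproduct
`Δ` of the free algebra `𝓘̃_•(S)` respects the relations (i)–(iv): every relator is killed by
`(π ⊗ π) ∘ Δ`. Cases (i), (iv): `map_coproductFree_eq_zero_of_mem_unitRel/loopRel`; cases (ii),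
(iii): `conv_shuffle`, `conv_path` — the functor-of-points form of Theorem 2.5 (c)
("`F` commutes with `∘` ⟺ (iii)+(iv); given that, `F` commutes with `δ` ⟺ (ii)", and such
automorphisms compose). [cite: Goncharov2005, Prop 2.2] -/
theorem coproduct_descends_holds : coproduct_descends S := by
  classical
  have hJ : ∀ a y b, phi (leftFam (S := S)) a y * phi leftFam y b = phi leftFam a b :=
    fun a y b => WordSeries.ext fun w => by rw [mul_apply]; exact (leftFam_path a b y w).symm
  have hK : ∀ a y b, phi (rightFam (S := S)) a y * phi rightFam y b = phi rightFam a b :=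
    fun a y b => WordSeries.ext fun w => by rw [mul_apply]; exact (rightFam_path a b y w).symm
  have hKii : ∀ a b,
      delta (phi (rightFam (S := S)) a b) = tensor (phi rightFam a b) (phi rightFam a b) :=
    fun a b => WordSeries.ext fun u => WordSeries.ext fun v => by
      rw [delta_apply, tensor_apply]; exact (rightFam_shuffle a b u v).symm
  rintro r (((hu | ⟨a, b, u, v, rfl⟩) | ⟨a, b, x, w, rfl⟩) | hl)
  · exact map_coproductFree_eq_zero_of_mem_unitRel hu
  · rw [map_sub, map_sub, sub_eq_zero, map_mul, map_mul, map_list_sum, map_list_sum, List.map_map,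
      List.map_map]
    simp only [Function.comp_def, map_coproductFree_gen]
    exact conv_shuffle leftFam_shuffle hKii hK a b u v
  · rw [map_sub, map_sub, sub_eq_zero, map_sum, map_sum]
    simp only [map_mul, map_coproductFree_gen]
    exact conv_path hJ hK a x b w
  · exact map_coproductFree_eq_zero_of_mem_loopRel hl

end Descent

end GoncharovFormalIteratedIntegrals

end Literature.NumberTheory.Transcendental
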